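import Mathlib
import HarnessLib
import Summits.RiemannHypothesis.RiemannHypothesis.Theses.DeBrangesSuzukiDoor

/-!
# RiemannHypothesis / DeBrangesSuzukiDoor — `Assembly` (stmt-RiemannHypothesis-19731) PROVED

The assembly step of route `route-RiemannHypothesis-DeBrangesSuzukiDoor`:
`WitnessDetectsRH → DoorWitness → RiemannHypothesis` — pick the witness's `θ`; pure logic (no analysis). The two
hypotheses are the rung leaf (proved: `witnessDetectsRH_proof`) and the route's DECLARED RESIDUAL `DoorWitness`
(RH-EQUIVALENT·DERIVED, never a proving target). RH-FREE; nothing here bears on the truth of RH.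
-/

-- D-0017: `Summit.<S>.<S>.…` is the designed namespace of a single-problem summit.
set_option linter.dupNamespace false

namespace Summit.RiemannHypothesis.RiemannHypothesis.Theorems

/-- **Route `DeBrangesSuzukiDoor`, `Assembly` (stmt-RiemannHypothesis-19731) — PROVED (pure logic).**
`WitnessDetectsRH → DoorWitness → RiemannHypothesis`: instantiate the rung leaf at the witness's `θ`. -/
theorem assembly_proof : Theses.DeBrangesSuzukiDoor.Assembly := by
  intro hT hW
  obtain ⟨θ, hθ, hWθ⟩ := hW
  exact hT θ hθ hWθ

end Summit.RiemannHypothesis.RiemannHypothesis.Theorems
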